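import Summits.Ventures.CertifiedManyBodySolver.Downfold.EmeryOrbitalWeightFace
import HarnessLib

/-!
# The ANTINODAL doping lever as a THEOREM: `dWeightFace(ε)` is strictly decreasing in the Fermi energy on the whole face window of every charge-transfer σ model
# (certificate file: a 311-term Positivstellensatz identity checked by `ring` + `positivity`)

Venture CertifiedManyBodySolver, cell `pub/hubbard-downfold` (stage S1; INFLATION-RULES-3to1-B §B.73), seat hubbard-downfold-mod-4 (technique B, g29); namespace
`Summit.Ventures.CertifiedManyBodySolver.Downfold.Emery`. Sequel of `EmeryOrbitalWeightFace` (§1 the closed form `dWeightFace = t_pd²faceN/(t_pd²faceN + faceR)`, §2 the face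
window `faceG ≥ 0`, `cA ≤ 8fsD + 16fsN` and positivity on it). Everything PROVED (0 sorry). WHAT THIS IS NOT: a statement about any material; `U = 0` one-body kinematics of
the σ model as printed; the weights below were FOUND by linear programming (kit jobs j338904 / j338910 of this seat: exact rational LP certificates, verified by exact
expansion) but nothing here trusts that search — the identity is re-checked by `ring` and the signs by `positivity`.

* §3 THE CERTIFICATE. With `d = ε₂ − ε₁`, `t_pp = c + h` (`c = t_pp′ ≥ 0`, `h = t_pp − t_pp′ ≥ 0`) and the three window forms `G₁ = faceG(ε₁) = ε₁(Δ + ε₁) + 4cε₁ − 4t_pd²`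
  (lower edge at the LOWER energy), `G₂ = (8fsD + 16fsN − cA)(ε₂)` (upper edge at the HIGHER energy), `M₂ = t_pd² − cε₂` (`fsD(ε₂) > 0`):
  **`faceN(ε₁)·faceR(ε₂) − faceN(ε₂)·faceR(ε₁) = d · faceCert(Δ, ε₁, d, t_pd, c, h, G₁, G₂, M₂)`** identically (`faceN_mul_faceR_sub`, by `ring`), where `faceCert` is a sum of
  311 products `λ · Δ^i ε₁^j d^k t_pd^{2l} c^m h^n · {1, G₁, G₂, M₂, G₁², G₁G₂, G₁M₂, G₂², G₂M₂}` with POSITIVE rational `λ` of denominator ≤ 24 (Handelman form of degree ≤ 2 in the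
  window generators; the pure term `Δ⁶d/4` makes it strict) — so `faceCert > 0` whenever `Δ, d > 0` and everything else is `≥ 0` (`faceCert_pos`, by `positivity`).
  HONEST NOTE: the sign is a WINDOW statement — off the window (`yFace < 0` with `t_pp ≫ t_pd`, or `yFace > 1`) it fails (seat-side exact-rational search), which is why no
  two-level shortcut like the node's (`EmeryOrbitalWeightNode`) exists and a certificate is the natural proof object.
* §4 **THE LEVER** (`dWeightFace_strictAnti`; `…'` in `yFace` language; `dWeightFace_lever` with the bounds `0 < w < 1`): `Δ > 0`, `0 ≤ t_pp′ ≤ t_pp`, `t_pd ≠ 0`, `0 < ε₁ < ε₂`,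
  `t_pp′ε₂ < t_pd²`, `yFace(ε₁) ≥ 0`, `yFace(ε₂) ≤ 1` ⇒ `dWeightFace(ε₂) < dWeightFace(ε₁)`. Hole doping (lower `ε_F`) ⇒ a MORE Cu-like ANTINODAL quasiparticle, electron
  doping ⇒ less; with `dWeightNode_strictAnti` and `dWeight_mem_Icc_node_face` both ends of the certified Fermi-surface Cu-d window `[w_node(ε), w_face(ε)]` move up under
  hole doping, for EVERY σ set in the regime — the one-body «by sign» statement of §B.23 of which the per-plane kernel decisions `doping_lever_rows` (34/34) / `tp_by_sign_rows`
  (5/5) of `EmeryBandLevelUVKYMR26Table` / `…TPrime` are instances.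
* §5 BRACKET FORM: both window edges are ONE-SIDED in the energy (`faceG` increasing — `faceG_mono`; the upper edge downward closed — `faceHi_anti`), so checking the lower
  edge at the bottom of a LOWER ε_F bracket and the upper edge (and `t_pp′e₂ < t_pd²`) at the top of a HIGHER one gives the lever for every pair of energies in between
  (`dWeightFace_strictAnti_of_edges`); `faceLeverCheck` is that test on rational inputs with soundness `dWeightFace_strictAnti_of_check` (census use: one `decide` per row).

Sources: three-band model [HybertsenSchluterChristensen1989, Eq. (1)]; bilinear contour [AndersenEtAl1995, §6]; polynomial positivity certificates on semialgebraic sets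
[folklore] (Handelman, Pacific J. Math. 132 (1988) 35–62); [folklore] algebra.
-/

noncomputable section

namespace Summit.Ventures.CertifiedManyBodySolver.Downfold.Emery

open Real Set

/-! ## §3 The two-point certificate (Handelman form; weights found by LP, checked here by `ring`/`positivity`) -/

/-- Part 1 of the certificate polynomial `faceCert` (31 positively weighted products). [folklore] -/
def faceCertP1 (_Δ ε₁ d tpd c h _G₁ _G₂ _M₂ : ℝ) : ℝ :=
  64 * d ^ 2 * tpd ^ 4 * h + 64 * d ^ 3 * c * h ^ 3 + 384 * d ^ 3 * tpd ^ 2 * c ^ 2 + 64 * d ^ 4 * c ^ 3 + 12 * d ^ 4 * tpd ^ 2 * h +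
  152 * d ^ 4 * tpd ^ 2 * c + 8 * d ^ 5 * c ^ 2 + 48 * ε₁ * d ^ 2 * tpd ^ 2 * h ^ 2 + 16 * ε₁ * d ^ 3 * tpd ^ 2 * h + 164 * ε₁ * d ^ 3 * tpd ^ 2 * c +
  8 * ε₁ * d ^ 4 * h ^ 2 + 16 * ε₁ * d ^ 4 * c * h + 11 * ε₁ * d ^ 5 * c + 52 * ε₁ ^ 2 * d * tpd ^ 2 * h ^ 2 + 88 * ε₁ ^ 2 * d * tpd ^ 2 * c * h +
  48 * ε₁ ^ 2 * d ^ 2 * tpd ^ 2 * h + 60 * ε₁ ^ 2 * d ^ 2 * tpd ^ 2 * c + 40 * ε₁ ^ 2 * d ^ 3 * h ^ 2 + 180 * ε₁ ^ 2 * d ^ 3 * c * h +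
  68 * ε₁ ^ 2 * d ^ 3 * c ^ 2 + 3 * ε₁ ^ 2 * d ^ 4 * c + 16 * ε₁ ^ 3 * d * h ^ 3 + 44 * ε₁ ^ 3 * d * c * h ^ 2 + 40 * ε₁ ^ 3 * d * c ^ 2 * h +
  24 * ε₁ ^ 3 * d ^ 2 * h ^ 2 + 108 * ε₁ ^ 3 * d ^ 2 * c * h + 60 * ε₁ ^ 3 * d ^ 2 * c ^ 2 + 12 * ε₁ ^ 3 * d ^ 3 * h + 3 * ε₁ ^ 4 * d * h ^ 2 +
  10 * ε₁ ^ 4 * d * c * h + 2 * ε₁ ^ 5 * d * h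

/-- `faceCertP1 ≥ 0` for non-negative arguments. [folklore] -/
theorem faceCertP1_nonneg {Δ ε₁ d tpd c h G₁ G₂ M₂ : ℝ} (h1 : 0 ≤ ε₁) (hd : 0 ≤ d) (hc : 0 ≤ c) (hh : 0 ≤ h) :
    0 ≤ faceCertP1 Δ ε₁ d tpd c h G₁ G₂ M₂ := by
  unfold faceCertP1
  positivity

/-- Part 2 of the certificate polynomial `faceCert` (31 positively weighted products). [folklore] -/
def faceCertP2 (Δ ε₁ d tpd c h _G₁ _G₂ _M₂ : ℝ) : ℝ :=
  192 * Δ * d * tpd ^ 4 * h + 64 * Δ * d ^ 2 * h ^ 4 + 512 / 3 * Δ * d ^ 2 * c * h ^ 3 + 512 * Δ * d ^ 2 * c ^ 4 + 256 * Δ * d ^ 2 * tpd ^ 2 * c ^ 2 +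
  448 * Δ * d ^ 3 * c ^ 3 + 152 * Δ * d ^ 3 * tpd ^ 2 * h + 488 * Δ * d ^ 3 * tpd ^ 2 * c + 24 * Δ * d ^ 4 * c * h + 216 * Δ * d ^ 4 * c ^ 2 +
  25 * Δ * d ^ 4 * tpd ^ 2 + 21 * Δ * d ^ 5 * c + 1 / 4 * Δ * d ^ 6 + 188 * Δ * ε₁ * d * tpd ^ 2 * h ^ 2 + 168 * Δ * ε₁ * d * tpd ^ 2 * c * h +
  112 * Δ * ε₁ * d ^ 2 * tpd ^ 2 * h + 136 * Δ * ε₁ * d ^ 2 * tpd ^ 2 * c + 24 * Δ * ε₁ * d ^ 3 * h ^ 2 + 120 * Δ * ε₁ * d ^ 3 * c * h +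
  152 * Δ * ε₁ * d ^ 3 * c ^ 2 + 4 * Δ * ε₁ * d ^ 4 * h + 56 * Δ * ε₁ * d ^ 4 * c + 5 / 2 * Δ * ε₁ * d ^ 5 + 208 / 3 * Δ * ε₁ ^ 2 * d * h ^ 3 +
  196 * Δ * ε₁ ^ 2 * d * c * h ^ 2 + 152 * Δ * ε₁ ^ 2 * d * c ^ 2 * h + 16 * Δ * ε₁ ^ 2 * d ^ 2 * h ^ 2 + 168 * Δ * ε₁ ^ 2 * d ^ 2 * c * h +
  96 * Δ * ε₁ ^ 2 * d ^ 2 * c ^ 2 + 4 * Δ * ε₁ ^ 3 * d ^ 3 + 128 * Δ ^ 2 * tpd ^ 2 * c * h ^ 2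

/-- `faceCertP2 ≥ 0` for non-negative arguments. [folklore] -/
theorem faceCertP2_nonneg {Δ ε₁ d tpd c h G₁ G₂ M₂ : ℝ} (hΔ : 0 ≤ Δ) (h1 : 0 ≤ ε₁) (hd : 0 ≤ d) (hc : 0 ≤ c) (hh : 0 ≤ h) :
    0 ≤ faceCertP2 Δ ε₁ d tpd c h G₁ G₂ M₂ := by
  unfold faceCertP2
  positivity

/-- Part 3 of the certificate polynomial `faceCert` (31 positively weighted products). [folklore] -/
def faceCertP3 (Δ ε₁ d tpd c h _G₁ _G₂ _M₂ : ℝ) : ℝ :=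
  512 * Δ ^ 2 * d * c ^ 3 * h + 512 * Δ ^ 2 * d * c ^ 4 + 108 * Δ ^ 2 * d * tpd ^ 2 * h ^ 2 + 448 * Δ ^ 2 * d * tpd ^ 2 * c * h +
  256 * Δ ^ 2 * d ^ 2 * c ^ 2 * h + 768 * Δ ^ 2 * d ^ 2 * c ^ 3 + 136 * Δ ^ 2 * d ^ 2 * tpd ^ 2 * h + 288 * Δ ^ 2 * d ^ 2 * tpd ^ 2 * c +
  116 * Δ ^ 2 * d ^ 3 * c * h + 464 * Δ ^ 2 * d ^ 3 * c ^ 2 + 83 / 2 * Δ ^ 2 * d ^ 3 * tpd ^ 2 + 4 * Δ ^ 2 * d ^ 4 * h + 70 * Δ ^ 2 * d ^ 4 * c +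
  3 / 2 * Δ ^ 2 * d ^ 5 + 64 * Δ ^ 2 * ε₁ * h ^ 4 + 256 * Δ ^ 2 * ε₁ * c * h ^ 3 + 128 * Δ ^ 2 * ε₁ * c ^ 2 * h ^ 2 + 160 / 3 * Δ ^ 2 * ε₁ * d * h ^ 3 +
  180 * Δ ^ 2 * ε₁ * d * c * h ^ 2 + 14 * Δ ^ 2 * ε₁ * d * tpd ^ 2 * h + 18 * Δ ^ 2 * ε₁ * d ^ 2 * h ^ 2 + 216 * Δ ^ 2 * ε₁ * d ^ 2 * c * h +
  216 * Δ ^ 2 * ε₁ * d ^ 2 * c ^ 2 + 93 / 2 * Δ ^ 2 * ε₁ * d ^ 3 * c + 17 / 8 * Δ ^ 2 * ε₁ * d ^ 4 + 3 / 2 * Δ ^ 2 * ε₁ ^ 2 * d * tpd ^ 2 +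
  4 * Δ ^ 2 * ε₁ ^ 3 * h ^ 2 + 3 / 2 * Δ ^ 2 * ε₁ ^ 3 * d * h + 5 / 2 * Δ ^ 2 * ε₁ ^ 3 * d * c + 15 / 8 * Δ ^ 2 * ε₁ ^ 3 * d ^ 2 +
  96 * Δ ^ 3 * d * c * h ^ 2

/-- `faceCertP3 ≥ 0` for non-negative arguments. [folklore] -/
theorem faceCertP3_nonneg {Δ ε₁ d tpd c h G₁ G₂ M₂ : ℝ} (hΔ : 0 ≤ Δ) (h1 : 0 ≤ ε₁) (hd : 0 ≤ d) (hc : 0 ≤ c) (hh : 0 ≤ h) :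
    0 ≤ faceCertP3 Δ ε₁ d tpd c h G₁ G₂ M₂ := by
  unfold faceCertP3
  positivity

/-- Part 4 of the certificate polynomial `faceCert` (31 positively weighted products). [folklore] -/
def faceCertP4 (Δ ε₁ d tpd c h _G₁ _G₂ _M₂ : ℝ) : ℝ :=
  448 * Δ ^ 3 * d * c ^ 2 * h + 384 * Δ ^ 3 * d * c ^ 3 + 44 * Δ ^ 3 * d * tpd ^ 2 * h + 4 * Δ ^ 3 * d * tpd ^ 2 * c + 3 * Δ ^ 3 * d ^ 2 * h ^ 2 +
  150 * Δ ^ 3 * d ^ 2 * c * h + 344 * Δ ^ 3 * d ^ 2 * c ^ 2 + 93 / 4 * Δ ^ 3 * d ^ 2 * tpd ^ 2 + 12 * Δ ^ 3 * d ^ 3 * h + 179 / 2 * Δ ^ 3 * d ^ 3 * c +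
  61 / 16 * Δ ^ 3 * d ^ 4 + 24 * Δ ^ 3 * ε₁ * d * c ^ 2 + 12 * Δ ^ 3 * ε₁ * d ^ 2 * h + 101 / 4 * Δ ^ 3 * ε₁ * d ^ 2 * c +
  21 / 16 * Δ ^ 3 * ε₁ * d ^ 3 + 8 * Δ ^ 3 * ε₁ ^ 2 * h ^ 2 + 1 / 16 * Δ ^ 3 * ε₁ ^ 3 * d + 12 * Δ ^ 4 * d * h ^ 2 + 80 * Δ ^ 4 * d * c * h +
  88 * Δ ^ 4 * d * c ^ 2 + 12 * Δ ^ 4 * d ^ 2 * h + 97 / 2 * Δ ^ 4 * d ^ 2 * c + 35 / 8 * Δ ^ 4 * d ^ 3 + 4 * Δ ^ 4 * ε₁ * h ^ 2 +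
  1 / 2 * Δ ^ 4 * ε₁ * d * h + 4 * Δ ^ 4 * ε₁ * d * c + 3 / 16 * Δ ^ 4 * ε₁ * d ^ 2 + 4 * Δ ^ 5 * d * h + 8 * Δ ^ 5 * d * c + 33 / 16 * Δ ^ 5 * d ^ 2 +
  3 / 16 * Δ ^ 5 * ε₁ * d

/-- `faceCertP4 ≥ 0` for non-negative arguments. [folklore] -/
theorem faceCertP4_nonneg {Δ ε₁ d tpd c h G₁ G₂ M₂ : ℝ} (hΔ : 0 ≤ Δ) (h1 : 0 ≤ ε₁) (hd : 0 ≤ d) (hc : 0 ≤ c) (hh : 0 ≤ h) :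
    0 ≤ faceCertP4 Δ ε₁ d tpd c h G₁ G₂ M₂ := by
  unfold faceCertP4
  positivity

/-- Part 5 of the certificate polynomial `faceCert` (31 positively weighted products). [folklore] -/
def faceCertP5 (Δ ε₁ d tpd c h G₁ _G₂ _M₂ : ℝ) : ℝ :=
  128 * d * c * h ^ 3 * G₁ + 512 * d * c ^ 2 * h ^ 2 * G₁ + 512 * d * c ^ 3 * h * G₁ + 128 * d * tpd ^ 2 * h ^ 2 * G₁ + 192 * d * tpd ^ 2 * c * h * G₁ +
  64 * d ^ 2 * c ^ 2 * h * G₁ + 72 * d ^ 2 * tpd ^ 2 * h * G₁ + 116 * d ^ 2 * tpd ^ 2 * c * G₁ + 80 * d ^ 3 * c ^ 2 * G₁ + 4 * d ^ 4 * h * G₁ +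
  36 * d ^ 4 * c * G₁ + 16 * ε₁ * d * h ^ 3 * G₁ + 24 * ε₁ * d * tpd ^ 2 * h * G₁ + 16 * ε₁ * d * tpd ^ 2 * c * G₁ + 48 * ε₁ * d ^ 2 * h ^ 2 * G₁ +
  64 * ε₁ * d ^ 2 * c * h * G₁ + 12 * ε₁ * d ^ 2 * c ^ 2 * G₁ + 2 * ε₁ * d ^ 3 * h * G₁ + 51 * ε₁ * d ^ 3 * c * G₁ + 5 * ε₁ ^ 2 * d * h ^ 2 * G₁ +
  54 * ε₁ ^ 2 * d * c * h * G₁ + 64 * ε₁ ^ 2 * d * c ^ 2 * G₁ + 6 * ε₁ ^ 3 * d * c * G₁ + 64 * Δ * h ^ 4 * G₁ + 384 * Δ * c * h ^ 3 * G₁ +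
  768 * Δ * c ^ 2 * h ^ 2 * G₁ + 512 * Δ * c ^ 3 * h * G₁ + 32 / 3 * Δ * tpd ^ 2 * c * h * G₁ + 512 / 3 * Δ * d * c * h ^ 2 * G₁ +
  448 * Δ * d * c ^ 2 * h * G₁ + 256 * Δ * d * c ^ 3 * G₁

/-- `faceCertP5 ≥ 0` for non-negative arguments. [folklore] -/
theorem faceCertP5_nonneg {Δ ε₁ d tpd c h G₁ G₂ M₂ : ℝ} (hΔ : 0 ≤ Δ) (h1 : 0 ≤ ε₁) (hd : 0 ≤ d) (hc : 0 ≤ c) (hh : 0 ≤ h) (hG₁ : 0 ≤ G₁) :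
    0 ≤ faceCertP5 Δ ε₁ d tpd c h G₁ G₂ M₂ := by
  unfold faceCertP5
  positivity

/-- Part 6 of the certificate polynomial `faceCert` (31 positively weighted products). [folklore] -/
def faceCertP6 (Δ ε₁ d tpd c h G₁ _G₂ _M₂ : ℝ) : ℝ :=
  376 / 3 * Δ * d * tpd ^ 2 * h * G₁ + 344 / 3 * Δ * d * tpd ^ 2 * c * G₁ + 136 / 3 * Δ * d ^ 2 * h ^ 2 * G₁ + 224 * Δ * d ^ 2 * c * h * G₁ +
  384 * Δ * d ^ 2 * c ^ 2 * G₁ + 83 / 3 * Δ * d ^ 2 * tpd ^ 2 * G₁ + 122 / 3 * Δ * d ^ 3 * h * G₁ + 508 / 3 * Δ * d ^ 3 * c * G₁ +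
  101 / 12 * Δ * d ^ 4 * G₁ + 64 / 3 * Δ * ε₁ * h ^ 3 * G₁ + 256 / 3 * Δ * ε₁ * c * h ^ 2 * G₁ + 224 / 3 * Δ * ε₁ * c ^ 2 * h * G₁ +
  161 / 3 * Δ * ε₁ * d * h ^ 2 * G₁ + 162 * Δ * ε₁ * d * c * h * G₁ + 296 / 3 * Δ * ε₁ * d * c ^ 2 * G₁ + 40 * Δ * ε₁ * d ^ 2 * h * G₁ +
  92 * Δ * ε₁ * d ^ 2 * c * G₁ + 55 / 6 * Δ * ε₁ * d ^ 3 * G₁ + 16 / 3 * Δ * ε₁ ^ 2 * c ^ 2 * G₁ + 4 / 3 * Δ * ε₁ ^ 3 * c * G₁ +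
  1 / 12 * Δ * ε₁ ^ 4 * G₁ + 64 * Δ ^ 2 * h ^ 3 * G₁ + 288 * Δ ^ 2 * c * h ^ 2 * G₁ + 384 * Δ ^ 2 * c ^ 2 * h * G₁ + 128 * Δ ^ 2 * c ^ 3 * G₁ +
  8 / 3 * Δ ^ 2 * tpd ^ 2 * c * G₁ + 193 / 3 * Δ ^ 2 * d * h ^ 2 * G₁ + 344 * Δ ^ 2 * d * c * h * G₁ + 336 * Δ ^ 2 * d * c ^ 2 * G₁ +
  55 / 6 * Δ ^ 2 * d * tpd ^ 2 * G₁ + 148 / 3 * Δ ^ 2 * d ^ 2 * h * G₁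

/-- `faceCertP6 ≥ 0` for non-negative arguments. [folklore] -/
theorem faceCertP6_nonneg {Δ ε₁ d tpd c h G₁ G₂ M₂ : ℝ} (hΔ : 0 ≤ Δ) (h1 : 0 ≤ ε₁) (hd : 0 ≤ d) (hc : 0 ≤ c) (hh : 0 ≤ h) (hG₁ : 0 ≤ G₁) :
    0 ≤ faceCertP6 Δ ε₁ d tpd c h G₁ G₂ M₂ := by
  unfold faceCertP6
  positivity

/-- Part 7 of the certificate polynomial `faceCert` (31 positively weighted products). [folklore] -/
def faceCertP7 (Δ ε₁ d tpd c h G₁ G₂ _M₂ : ℝ) : ℝ :=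
  524 / 3 * Δ ^ 2 * d ^ 2 * c * G₁ + 135 / 8 * Δ ^ 2 * d ^ 3 * G₁ + 8 * Δ ^ 2 * ε₁ * h ^ 2 * G₁ + 40 * Δ ^ 2 * ε₁ * c * h * G₁ +
  56 / 3 * Δ ^ 2 * ε₁ * c ^ 2 * G₁ + 103 / 6 * Δ ^ 2 * ε₁ * d * h * G₁ + 229 / 6 * Δ ^ 2 * ε₁ * d * c * G₁ + 13 / 2 * Δ ^ 2 * ε₁ * d ^ 2 * G₁ +
  16 * Δ ^ 3 * h ^ 2 * G₁ + 72 * Δ ^ 3 * c * h * G₁ + 48 * Δ ^ 3 * c ^ 2 * G₁ + 193 / 6 * Δ ^ 3 * d * h * G₁ + 208 / 3 * Δ ^ 3 * d * c * G₁ +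
  219 / 16 * Δ ^ 3 * d ^ 2 * G₁ + 4 * Δ ^ 3 * ε₁ * h * G₁ + 14 / 3 * Δ ^ 3 * ε₁ * c * G₁ + 41 / 12 * Δ ^ 3 * ε₁ * d * G₁ + 4 * Δ ^ 4 * h * G₁ +
  6 * Δ ^ 4 * c * G₁ + 91 / 24 * Δ ^ 4 * d * G₁ + 1 / 3 * Δ ^ 4 * ε₁ * G₁ + 1 / 4 * Δ ^ 5 * G₁ + 12 * d * tpd ^ 2 * h * G₂ + 36 * d * tpd ^ 2 * c * G₂ +
  16 * d ^ 2 * c ^ 2 * G₂ + 1 * d ^ 3 * c * G₂ + 8 * ε₁ * tpd ^ 2 * h * G₂ + 24 * ε₁ * tpd ^ 2 * c * G₂ + 8 * ε₁ * d * h ^ 2 * G₂ +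
  28 * ε₁ * d * c * h * G₂ + 12 * ε₁ * d * c ^ 2 * G₂

/-- `faceCertP7 ≥ 0` for non-negative arguments. [folklore] -/
theorem faceCertP7_nonneg {Δ ε₁ d tpd c h G₁ G₂ M₂ : ℝ} (hΔ : 0 ≤ Δ) (h1 : 0 ≤ ε₁) (hd : 0 ≤ d) (hc : 0 ≤ c) (hh : 0 ≤ h) (hG₁ : 0 ≤ G₁) (hG₂ : 0 ≤ G₂) :
    0 ≤ faceCertP7 Δ ε₁ d tpd c h G₁ G₂ M₂ := by
  unfold faceCertP7
  positivity

/-- Part 8 of the certificate polynomial `faceCert` (31 positively weighted products). [folklore] -/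
def faceCertP8 (Δ ε₁ d tpd c h _G₁ G₂ _M₂ : ℝ) : ℝ :=
  14 * ε₁ * d ^ 2 * c * G₂ + 12 * ε₁ ^ 2 * h ^ 2 * G₂ + 40 * ε₁ ^ 2 * c * h * G₂ + 24 * ε₁ ^ 2 * c ^ 2 * G₂ + 2 * ε₁ ^ 3 * h * G₂ +
  16 * Δ * c * h ^ 2 * G₂ + 64 * Δ * c ^ 2 * h * G₂ + 64 * Δ * c ^ 3 * G₂ + 32 * Δ * tpd ^ 2 * h * G₂ + 36 * Δ * tpd ^ 2 * c * G₂ +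
  32 * Δ * d * c * h * G₂ + 56 * Δ * d * c ^ 2 * G₂ + 4 * Δ * d * tpd ^ 2 * G₂ + 23 * Δ * d ^ 2 * c * G₂ + 1 / 2 * Δ * d ^ 3 * G₂ +
  20 * Δ * ε₁ * h ^ 2 * G₂ + 48 * Δ * ε₁ * c * h * G₂ + 44 * Δ * ε₁ * c ^ 2 * G₂ + 4 * Δ * ε₁ * d * h * G₂ + 15 * Δ * ε₁ * d * c * G₂ +
  5 / 2 * Δ * ε₁ * d ^ 2 * G₂ + 8 * Δ ^ 2 * h ^ 2 * G₂ + 48 * Δ ^ 2 * c * h * G₂ + 48 * Δ ^ 2 * c ^ 2 * G₂ + 1 * Δ ^ 2 * tpd ^ 2 * G₂ +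
  4 * Δ ^ 2 * d * h * G₂ + 25 * Δ ^ 2 * d * c * G₂ + 3 / 2 * Δ ^ 2 * d ^ 2 * G₂ + 2 * Δ ^ 2 * ε₁ * h * G₂ + 6 * Δ ^ 2 * ε₁ * c * G₂ +
  7 / 8 * Δ ^ 2 * ε₁ * d * G₂

/-- `faceCertP8 ≥ 0` for non-negative arguments. [folklore] -/
theorem faceCertP8_nonneg {Δ ε₁ d tpd c h G₁ G₂ M₂ : ℝ} (hΔ : 0 ≤ Δ) (h1 : 0 ≤ ε₁) (hd : 0 ≤ d) (hc : 0 ≤ c) (hh : 0 ≤ h) (hG₂ : 0 ≤ G₂) :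
    0 ≤ faceCertP8 Δ ε₁ d tpd c h G₁ G₂ M₂ := by
  unfold faceCertP8
  positivity

/-- Part 9 of the certificate polynomial `faceCert` (31 positively weighted products). [folklore] -/
def faceCertP9 (Δ ε₁ d _tpd c h G₁ G₂ M₂ : ℝ) : ℝ :=
  4 * Δ ^ 3 * h * G₂ + 7 * Δ ^ 3 * c * G₂ + 29 / 16 * Δ ^ 3 * d * G₂ + 1 / 4 * Δ ^ 3 * ε₁ * G₂ + 1 / 4 * Δ ^ 4 * G₂ + 256 * d ^ 2 * c ^ 2 * h * M₂ +
  32 * d ^ 3 * c * h * M₂ + 4 * d ^ 4 * h * M₂ + 64 * ε₁ * d * h ^ 3 * M₂ + 128 * ε₁ * d * c * h ^ 2 * M₂ + 112 * ε₁ * d ^ 2 * h ^ 2 * M₂ +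
  64 * ε₁ * d ^ 2 * c * h * M₂ + 512 / 3 * Δ * d * h ^ 3 * M₂ + 384 * Δ * d * c * h ^ 2 * M₂ + 272 * Δ * d ^ 2 * h ^ 2 * M₂ +
  320 * Δ * d ^ 2 * c * h * M₂ + 80 * Δ * ε₁ * d * h ^ 2 * M₂ + 128 * Δ ^ 2 * h ^ 3 * M₂ + 128 * Δ ^ 2 * c * h ^ 2 * M₂ + 128 * Δ ^ 2 * d * h ^ 2 * M₂ +
  32 * h ^ 3 * G₁ ^ 2 + 128 * c * h ^ 2 * G₁ ^ 2 + 128 * c ^ 2 * h * G₁ ^ 2 + 48 * d * h ^ 2 * G₁ ^ 2 + 80 * d * c * h * G₁ ^ 2 +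
  18 * d ^ 2 * h * G₁ ^ 2 + 29 * d ^ 2 * c * G₁ ^ 2 + 16 * ε₁ * h ^ 2 * G₁ ^ 2 + 32 * ε₁ * c * h * G₁ ^ 2 + 8 * ε₁ * d * h * G₁ ^ 2 +
  2 * ε₁ ^ 2 * h * G₁ ^ 2

/-- `faceCertP9 ≥ 0` for non-negative arguments. [folklore] -/
theorem faceCertP9_nonneg {Δ ε₁ d tpd c h G₁ G₂ M₂ : ℝ} (hΔ : 0 ≤ Δ) (h1 : 0 ≤ ε₁) (hd : 0 ≤ d) (hc : 0 ≤ c) (hh : 0 ≤ h) (hG₂ : 0 ≤ G₂) (hM₂ : 0 ≤ M₂) :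
    0 ≤ faceCertP9 Δ ε₁ d tpd c h G₁ G₂ M₂ := by
  unfold faceCertP9
  positivity

/-- Part 10 of the certificate polynomial `faceCert` (31 positively weighted products). [folklore] -/
def faceCertP10 (Δ ε₁ d _tpd c h G₁ G₂ M₂ : ℝ) : ℝ :=
  112 / 3 * Δ * h ^ 2 * G₁ ^ 2 + 280 / 3 * Δ * c * h * G₁ ^ 2 + 32 * Δ * c ^ 2 * G₁ ^ 2 + 40 * Δ * d * h * G₁ ^ 2 + 166 / 3 * Δ * d * c * G₁ ^ 2 +
  41 / 4 * Δ * d ^ 2 * G₁ ^ 2 + 32 / 3 * Δ * ε₁ * h * G₁ ^ 2 + 20 / 3 * Δ * ε₁ * c * G₁ ^ 2 + 11 / 3 * Δ * ε₁ * d * G₁ ^ 2 +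
  1 / 3 * Δ * ε₁ ^ 2 * G₁ ^ 2 + 38 / 3 * Δ ^ 2 * h * G₁ ^ 2 + 46 / 3 * Δ ^ 2 * c * G₁ ^ 2 + 167 / 24 * Δ ^ 2 * d * G₁ ^ 2 +
  5 / 3 * Δ ^ 2 * ε₁ * G₁ ^ 2 + 4 / 3 * Δ ^ 3 * G₁ ^ 2 + 4 * h ^ 2 * G₁ * G₂ + 8 * c * h * G₁ * G₂ + 4 * d * h * G₁ * G₂ + 9 * d * c * G₁ * G₂ +
  2 * ε₁ * c * G₁ * G₂ + 32 / 3 * Δ * h * G₁ * G₂ + 11 * Δ * c * G₁ * G₂ + 19 / 6 * Δ * d * G₁ * G₂ + 2 / 3 * Δ * ε₁ * G₁ * G₂ +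
  17 / 12 * Δ ^ 2 * G₁ * G₂ + 8 * d ^ 2 * h * G₁ * M₂ + 1 * c * G₂ ^ 2 + 1 / 4 * Δ * G₂ ^ 2 + 16 * h ^ 2 * G₂ * M₂ + 32 * c * h * G₂ * M₂ +
  4 * d * h * G₂ * M₂

/-- `faceCertP10 ≥ 0` for non-negative arguments. [folklore] -/
theorem faceCertP10_nonneg {Δ ε₁ d tpd c h G₁ G₂ M₂ : ℝ} (hΔ : 0 ≤ Δ) (h1 : 0 ≤ ε₁) (hd : 0 ≤ d) (hc : 0 ≤ c) (hh : 0 ≤ h) (hG₁ : 0 ≤ G₁) (hG₂ : 0 ≤ G₂) (hM₂ : 0 ≤ M₂) :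
    0 ≤ faceCertP10 Δ ε₁ d tpd c h G₁ G₂ M₂ := by
  unfold faceCertP10
  positivity

/-- **The certificate polynomial** `faceCert Δ ε₁ d t c h G₁ G₂ M₂` (`d = ε₂ − ε₁`, `t = t_pd`, `c = t_pp′`, `h = t_pp − t_pp′`; `G₁ = faceG(ε₁)`, `G₂ = 8fsD + 16fsN − cA` at `ε₂`,
`M₂ = t_pd² − t_pp′ε₂`): the strict term `(1 / 4)·Δ⁶·d` plus 310 products of monomials and window forms with positive rational weights (denominators ≤ 24),
in 10 parts. [folklore] -/
def faceCert (Δ ε₁ d tpd c h G₁ G₂ M₂ : ℝ) : ℝ :=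
  1 / 4 * Δ ^ 6 * d +
    faceCertP1 Δ ε₁ d tpd c h G₁ G₂ M₂ +
    faceCertP2 Δ ε₁ d tpd c h G₁ G₂ M₂ +
    faceCertP3 Δ ε₁ d tpd c h G₁ G₂ M₂ +
    faceCertP4 Δ ε₁ d tpd c h G₁ G₂ M₂ +
    faceCertP5 Δ ε₁ d tpd c h G₁ G₂ M₂ +
    faceCertP6 Δ ε₁ d tpd c h G₁ G₂ M₂ +
    faceCertP7 Δ ε₁ d tpd c h G₁ G₂ M₂ +
    faceCertP8 Δ ε₁ d tpd c h G₁ G₂ M₂ +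
    faceCertP9 Δ ε₁ d tpd c h G₁ G₂ M₂ +
    faceCertP10 Δ ε₁ d tpd c h G₁ G₂ M₂

/-- `faceCert > 0` for `Δ, d > 0` and all other arguments `≥ 0`. [folklore] -/
theorem faceCert_pos {Δ ε₁ d tpd c h G₁ G₂ M₂ : ℝ} (hΔ : 0 < Δ) (h1 : 0 ≤ ε₁) (hd : 0 < d) (hc : 0 ≤ c) (hh : 0 ≤ h) (hG₁ : 0 ≤ G₁) (hG₂ : 0 ≤ G₂)
    (hM₂ : 0 ≤ M₂) : 0 < faceCert Δ ε₁ d tpd c h G₁ G₂ M₂ := by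
  have p1 : 0 ≤ faceCertP1 Δ ε₁ d tpd c h G₁ G₂ M₂ := faceCertP1_nonneg (tpd := tpd) (h1 := h1) (hd := hd.le) (hc := hc) (hh := hh)
  have p2 : 0 ≤ faceCertP2 Δ ε₁ d tpd c h G₁ G₂ M₂ := faceCertP2_nonneg (tpd := tpd) (hΔ := hΔ.le) (h1 := h1) (hd := hd.le) (hc := hc) (hh := hh)
  have p3 : 0 ≤ faceCertP3 Δ ε₁ d tpd c h G₁ G₂ M₂ := faceCertP3_nonneg (tpd := tpd) (hΔ := hΔ.le) (h1 := h1) (hd := hd.le) (hc := hc) (hh := hh)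
  have p4 : 0 ≤ faceCertP4 Δ ε₁ d tpd c h G₁ G₂ M₂ := faceCertP4_nonneg (tpd := tpd) (hΔ := hΔ.le) (h1 := h1) (hd := hd.le) (hc := hc) (hh := hh)
  have p5 : 0 ≤ faceCertP5 Δ ε₁ d tpd c h G₁ G₂ M₂ := faceCertP5_nonneg (tpd := tpd) (hΔ := hΔ.le) (h1 := h1) (hd := hd.le) (hc := hc) (hh := hh) (hG₁ := hG₁)
  have p6 : 0 ≤ faceCertP6 Δ ε₁ d tpd c h G₁ G₂ M₂ := faceCertP6_nonneg (tpd := tpd) (hΔ := hΔ.le) (h1 := h1) (hd := hd.le) (hc := hc) (hh := hh) (hG₁ := hG₁)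
  have p7 : 0 ≤ faceCertP7 Δ ε₁ d tpd c h G₁ G₂ M₂ := faceCertP7_nonneg (tpd := tpd) (hΔ := hΔ.le) (h1 := h1) (hd := hd.le) (hc := hc) (hh := hh) (hG₁ := hG₁) (hG₂ := hG₂)
  have p8 : 0 ≤ faceCertP8 Δ ε₁ d tpd c h G₁ G₂ M₂ := faceCertP8_nonneg (tpd := tpd) (hΔ := hΔ.le) (h1 := h1) (hd := hd.le) (hc := hc) (hh := hh) (hG₂ := hG₂)
  have p9 : 0 ≤ faceCertP9 Δ ε₁ d tpd c h G₁ G₂ M₂ := faceCertP9_nonneg (tpd := tpd) (hΔ := hΔ.le) (h1 := h1) (hd := hd.le) (hc := hc) (hh := hh) (hG₂ := hG₂) (hM₂ := hM₂)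
  have p10 : 0 ≤ faceCertP10 Δ ε₁ d tpd c h G₁ G₂ M₂ := faceCertP10_nonneg (tpd := tpd) (hΔ := hΔ.le) (h1 := h1) (hd := hd.le) (hc := hc) (hh := hh) (hG₁ := hG₁) (hG₂ := hG₂) (hM₂ := hM₂)
  unfold faceCert
  positivity

/-- **THE CERTIFICATE IDENTITY**: `faceN(ε₁)·faceR(ε₁ + d) − faceN(ε₁ + d)·faceR(ε₁) = d·faceCert(…, faceG(ε₁), (8fsD + 16fsN − cA)(ε₁ + d), t_pd² − t_pp′(ε₁ + d))` identically
(`t_pp = c + h`). [folklore] -/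
theorem faceN_mul_faceR_sub (Δ tpd c h ε₁ d : ℝ) :
    faceN Δ (c + h) c ε₁ * faceR Δ tpd (c + h) c (ε₁ + d) - faceN Δ (c + h) c (ε₁ + d) * faceR Δ tpd (c + h) c ε₁ =
      d * faceCert Δ ε₁ d tpd c h (ε₁ * (Δ + ε₁) + 4 * c * ε₁ - 4 * tpd ^ 2)
        (8 * (Δ + (ε₁ + d)) * (tpd ^ 2 - c * (ε₁ + d)) + 16 * (c + h + c) * (2 * tpd ^ 2 + h * (ε₁ + d)) - (ε₁ + d) * (Δ + (ε₁ + d)) ^ 2)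
        (tpd ^ 2 - c * (ε₁ + d)) := by
  unfold faceN faceR fsN faceCert faceCertP1 faceCertP2 faceCertP3 faceCertP4 faceCertP5 faceCertP6 faceCertP7 faceCertP8 faceCertP9 faceCertP10
  ring

/-! ## §4 The doping lever at the antinode -/

/-- **THE ANTINODAL d-WEIGHT IS STRICTLY DECREASING IN THE FERMI ENERGY ON THE FACE WINDOW** (`Δ > 0`, `0 ≤ t_pp′ ≤ t_pp`, `t_pd ≠ 0`; `0 < ε₁ < ε₂` with `t_pp′ε₂ < t_pd²`,
the contour AT `ε₁` reaching the zone face (`faceG(ε₁) ≥ 0`, i.e. `yFace(ε₁) ≥ 0`) and the contour AT `ε₂` still inside the zone on the face (`cA ≤ 8fsD + 16fsN`, i.e.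
`yFace(ε₂) ≤ 1`)): `dWeightFace(ε₂) < dWeightFace(ε₁)`. Hole doping (lower `ε_F`) ⇒ a MORE Cu-like antinodal quasiparticle; electron doping ⇒ less. [folklore] -/
theorem dWeightFace_strictAnti {Δ tpd tpp c ε₁ ε₂ : ℝ} (hΔ : 0 < Δ) (hc : 0 ≤ c) (hct : c ≤ tpp) (htpd : tpd ≠ 0) (h1 : 0 < ε₁) (h12 : ε₁ < ε₂)
    (hm : c * ε₂ < tpd ^ 2) (hlo : 0 ≤ faceG Δ tpd c ε₁) (hhi : cA Δ ε₂ ≤ 8 * fsD Δ tpd c ε₂ + 16 * fsN tpd tpp c ε₂) :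
    dWeightFace Δ tpd tpp c ε₂ < dWeightFace Δ tpd tpp c ε₁ := by
  have h2 : 0 < ε₂ := h1.trans h12
  have hm1 : c * ε₁ < tpd ^ 2 := lt_of_le_of_lt (mul_le_mul_of_nonneg_left h12.le hc) hm
  have hE1 : 0 < Δ + ε₁ := by linarith
  have hE2 : 0 < Δ + ε₂ := by linarith
  have hlo2 : 0 ≤ faceG Δ tpd c ε₂ := hlo.trans (faceG_mono hΔ.le hc h1.le h12.le)
  have hF1 : 0 < 4 * fsD Δ tpd c ε₁ + 16 * fsN tpd tpp c ε₁ := by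
    have := fsD_pos hE1 hm1; have := fsN_nonneg (tpd := tpd) hc hct h1.le; positivity
  have hF2 : 0 < 4 * fsD Δ tpd c ε₂ + 16 * fsN tpd tpp c ε₂ := by
    have := fsD_pos hE2 hm; have := fsN_nonneg (tpd := tpd) hc hct h2.le; positivity
  have hR1 := faceR_pos hE1 hc hct h1 hm1 hlo
  have hR2 := faceR_pos hE2 hc hct h2 hm hlo2
  have hN1 := faceN_pos (Δ := Δ) (ε := ε₁) hE1 (by linarith : 0 ≤ tpp + c)
  have hN2 := faceN_pos (Δ := Δ) (ε := ε₂) hE2 (by linarith : 0 ≤ tpp + c)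
  have ht : 0 < tpd ^ 2 := by positivity
  rw [dWeightFace_eq h2.ne' hF2.ne' (dcharCubic_face_pos hE2 hc hct h2 hm hlo2).ne',
    dWeightFace_eq h1.ne' hF1.ne' (dcharCubic_face_pos hE1 hc hct h1 hm1 hlo).ne',
    div_lt_div_iff₀ (by positivity) (by positivity), ← sub_pos]
  -- the cross difference is `t_pd² · (faceN₁·faceR₂ − faceN₂·faceR₁) = t_pd² · d · faceCert`
  obtain ⟨h, rfl⟩ : ∃ h, tpp = c + h := ⟨tpp - c, by ring⟩
  obtain ⟨d, rfl⟩ : ∃ d, ε₂ = ε₁ + d := ⟨ε₂ - ε₁, by ring⟩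
  have hh : 0 ≤ h := by linarith
  have hd : 0 < d := by linarith
  have hG₂ : 0 ≤ 8 * (Δ + (ε₁ + d)) * (tpd ^ 2 - c * (ε₁ + d)) + 16 * (c + h + c) * (2 * tpd ^ 2 + h * (ε₁ + d)) - (ε₁ + d) * (Δ + (ε₁ + d)) ^ 2 := by
    have e := faceHi_eq Δ tpd (c + h) c (ε₁ + d)
    simp only [add_sub_cancel_left] at e
    linarith
  have hM₂ : 0 ≤ tpd ^ 2 - c * (ε₁ + d) := by linarith
  have hG₁ : 0 ≤ ε₁ * (Δ + ε₁) + 4 * c * ε₁ - 4 * tpd ^ 2 := by unfold faceG at hlo; exact hlo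
  have key := faceN_mul_faceR_sub Δ tpd c h ε₁ d
  have hC := faceCert_pos (tpd := tpd) hΔ h1.le hd hc hh hG₁ hG₂ hM₂
  have e : tpd ^ 2 * faceN Δ (c + h) c ε₁ * (tpd ^ 2 * faceN Δ (c + h) c (ε₁ + d) + faceR Δ tpd (c + h) c (ε₁ + d)) -
      tpd ^ 2 * faceN Δ (c + h) c (ε₁ + d) * (tpd ^ 2 * faceN Δ (c + h) c ε₁ + faceR Δ tpd (c + h) c ε₁) =
      tpd ^ 2 * (faceN Δ (c + h) c ε₁ * faceR Δ tpd (c + h) c (ε₁ + d) - faceN Δ (c + h) c (ε₁ + d) * faceR Δ tpd (c + h) c ε₁) := by ring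
  rw [e, key]
  exact mul_pos ht (mul_pos hd hC)

/-- The same lever with the window in `yFace` language (`0 ≤ yFace(ε₁)`, `yFace(ε₂) ≤ 1`). [folklore] -/
theorem dWeightFace_strictAnti' {Δ tpd tpp c ε₁ ε₂ : ℝ} (hΔ : 0 < Δ) (hc : 0 ≤ c) (hct : c ≤ tpp) (htpd : tpd ≠ 0) (h1 : 0 < ε₁) (h12 : ε₁ < ε₂)
    (hm : c * ε₂ < tpd ^ 2) (hlo : 0 ≤ yFace Δ tpd tpp c ε₁) (hhi : yFace Δ tpd tpp c ε₂ ≤ 1) :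
    dWeightFace Δ tpd tpp c ε₂ < dWeightFace Δ tpd tpp c ε₁ := by
  have h2 : 0 < ε₂ := h1.trans h12
  have hm1 : c * ε₁ < tpd ^ 2 := lt_of_le_of_lt (mul_le_mul_of_nonneg_left h12.le hc) hm
  have hF1 : 0 < 4 * fsD Δ tpd c ε₁ + 16 * fsN tpd tpp c ε₁ := by
    have := fsD_pos (by linarith : 0 < Δ + ε₁) hm1; have := fsN_nonneg (tpd := tpd) hc hct h1.le; positivity
  have hF2 : 0 < 4 * fsD Δ tpd c ε₂ + 16 * fsN tpd tpp c ε₂ := by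
    have := fsD_pos (by linarith : 0 < Δ + ε₂) hm; have := fsN_nonneg (tpd := tpd) hc hct h2.le; positivity
  exact dWeightFace_strictAnti hΔ hc hct htpd h1 h12 hm ((yFace_nonneg_iff hF1 (by linarith)).1 hlo) ((yFace_le_one_iff hF2).1 hhi)

/-- **BY SIGN, BOTH ENDS**: on the face window, hole doping (`ε₁ < ε₂`, read from `ε₂` down to `ε₁`) raises the antinodal weight and never lets it reach `1`; combined with
`dWeightNode_strictAnti` (node) and `dWeight_mem_Icc_node_face` (every Fermi point lies between), the certified Fermi-surface Cu-d window `[w_node(ε), w_face(ε)]` slides UP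
rigidly-in-order as `ε` decreases. Stated here for the face end together with its bounds. [folklore] -/
theorem dWeightFace_lever {Δ tpd tpp c ε₁ ε₂ : ℝ} (hΔ : 0 < Δ) (hc : 0 ≤ c) (hct : c ≤ tpp) (htpd : tpd ≠ 0) (h1 : 0 < ε₁) (h12 : ε₁ < ε₂)
    (hm : c * ε₂ < tpd ^ 2) (hlo : 0 ≤ faceG Δ tpd c ε₁) (hhi : cA Δ ε₂ ≤ 8 * fsD Δ tpd c ε₂ + 16 * fsN tpd tpp c ε₂) :
    0 < dWeightFace Δ tpd tpp c ε₂ ∧ dWeightFace Δ tpd tpp c ε₂ < dWeightFace Δ tpd tpp c ε₁ ∧ dWeightFace Δ tpd tpp c ε₁ < 1 := by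
  have h2 : 0 < ε₂ := h1.trans h12
  have hlo2 : 0 ≤ faceG Δ tpd c ε₂ := hlo.trans (faceG_mono hΔ.le hc h1.le h12.le)
  have hm1 : c * ε₁ < tpd ^ 2 := lt_of_le_of_lt (mul_le_mul_of_nonneg_left h12.le hc) hm
  exact ⟨(dWeightFace_mem_Ioo (by linarith) hc hct h2 htpd hm hlo2).1, dWeightFace_strictAnti hΔ hc hct htpd h1 h12 hm hlo hhi,
    (dWeightFace_mem_Ioo (by linarith) hc hct h1 htpd hm1 hlo).2⟩

/-! ## §5 Bracket form: the window edges are one-sided in the energy, so ONE rational check per (σ set, pair of fillings) words the lever for whole ε_F brackets -/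

/-- The UPPER edge of the face window is downward closed in the energy: `0 < ε₁ ≤ ε₂`, `(cA ≤ 8fsD + 16fsN)(ε₂) ⇒ (cA ≤ 8fsD + 16fsN)(ε₁)` (`Δ, t_pp′ ≥ 0`,
`t_pp + t_pp′ ≥ 0`; from `ε₂·g(ε₁) − ε₁·g(ε₂) = (ε₂ − ε₁)[ε₁ε₂(ε₁ + ε₂) + (2Δ + 8t_pp′)ε₁ε₂ + 8t_pd²(Δ + 4g)] ≥ 0` for the cubic `g = 8fsD + 16fsN − cA`). [folklore] -/
theorem faceHi_anti {Δ tpd tpp c ε₁ ε₂ : ℝ} (hΔ : 0 ≤ Δ) (hc : 0 ≤ c) (hg : 0 ≤ tpp + c) (h1 : 0 < ε₁) (h12 : ε₁ ≤ ε₂)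
    (h2 : cA Δ ε₂ ≤ 8 * fsD Δ tpd c ε₂ + 16 * fsN tpd tpp c ε₂) : cA Δ ε₁ ≤ 8 * fsD Δ tpd c ε₁ + 16 * fsN tpd tpp c ε₁ := by
  have h2' : 0 < ε₂ := lt_of_lt_of_le h1 h12
  have key : ε₂ * (8 * fsD Δ tpd c ε₁ + 16 * fsN tpd tpp c ε₁ - cA Δ ε₁) - ε₁ * (8 * fsD Δ tpd c ε₂ + 16 * fsN tpd tpp c ε₂ - cA Δ ε₂) =
      (ε₂ - ε₁) * (ε₁ * ε₂ * (ε₁ + ε₂) + (2 * Δ + 8 * c) * (ε₁ * ε₂) + 8 * tpd ^ 2 * (Δ + 4 * (tpp + c))) := by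
    unfold fsD fsN cA; ring
  have hrhs : 0 ≤ (ε₂ - ε₁) * (ε₁ * ε₂ * (ε₁ + ε₂) + (2 * Δ + 8 * c) * (ε₁ * ε₂) + 8 * tpd ^ 2 * (Δ + 4 * (tpp + c))) := by
    have : 0 ≤ ε₂ - ε₁ := sub_nonneg.2 h12
    positivity
  have hx : 0 ≤ ε₁ * (8 * fsD Δ tpd c ε₂ + 16 * fsN tpd tpp c ε₂ - cA Δ ε₂) := mul_nonneg h1.le (by linarith)
  have hy : 0 ≤ ε₂ * (8 * fsD Δ tpd c ε₁ + 16 * fsN tpd tpp c ε₁ - cA Δ ε₁) := by linarith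
  have hX : 0 ≤ 8 * fsD Δ tpd c ε₁ + 16 * fsN tpd tpp c ε₁ - cA Δ ε₁ := by
    by_contra hX
    push Not at hX
    have := mul_neg_of_pos_of_neg h2' hX
    linarith
  linarith

/-- **THE LEVER FOR WHOLE BRACKETS**: if the lower window edge holds at `e₁` and the upper edge and `t_pp′e₂ < t_pd²` hold at `e₂ ≥ e₁`, then for ALL `e₁ ≤ ε₁ < ε₂ ≤ e₂`:
`dWeightFace(ε₂) < dWeightFace(ε₁)` — so a hole-doped ε_F bracket below a parent ε_F bracket inherits the sign row by row without any window arithmetic in between. [folklore] -/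
theorem dWeightFace_strictAnti_of_edges {Δ tpd tpp c e₁ e₂ ε₁ ε₂ : ℝ} (hΔ : 0 < Δ) (hc : 0 ≤ c) (hct : c ≤ tpp) (htpd : tpd ≠ 0) (he₁ : 0 < e₁)
    (hm : c * e₂ < tpd ^ 2) (hlo : 0 ≤ faceG Δ tpd c e₁) (hhi : cA Δ e₂ ≤ 8 * fsD Δ tpd c e₂ + 16 * fsN tpd tpp c e₂)
    (h1 : e₁ ≤ ε₁) (h12 : ε₁ < ε₂) (h2 : ε₂ ≤ e₂) : dWeightFace Δ tpd tpp c ε₂ < dWeightFace Δ tpd tpp c ε₁ := by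
  have hε₁ : 0 < ε₁ := lt_of_lt_of_le he₁ h1
  have hε₂ : 0 < ε₂ := hε₁.trans h12
  exact dWeightFace_strictAnti hΔ hc hct htpd hε₁ h12 (lt_of_le_of_lt (mul_le_mul_of_nonneg_left h2 hc) hm)
    (hlo.trans (faceG_mono hΔ.le hc he₁.le h1)) (faceHi_anti hΔ.le hc (by linarith) hε₂ h2 hhi)

/-- **`faceLeverCheck`** — the kernel-decidable bracket rule. Inputs: a σ one-body point `(Δ, a, b, c) = (Δ_pd, t_pd, t_pp, t_pp′) ∈ ℚ⁴` and two energies `e₁ ≤ e₂`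
(the lower end of the LOWER ε_F bracket and the upper end of the HIGHER one). A plain conjunction of rational tests: regime, `t_pp′e₂ < t_pd²`, lower edge at `e₁`, upper edge at `e₂`. [folklore] -/
def faceLeverCheck (Δ a b c e₁ e₂ : ℚ) : Bool :=
  decide (0 < Δ) && decide (0 ≤ c) && decide (c ≤ b) && decide (a ≠ 0) && decide (0 < e₁) && decide (c * e₂ < a ^ 2) &&
  decide (0 ≤ e₁ * (Δ + e₁) + 4 * c * e₁ - 4 * a ^ 2) &&
  decide (e₂ * (Δ + e₂) ^ 2 ≤ 8 * ((Δ + e₂) * (a ^ 2 - c * e₂)) + 16 * (2 * a ^ 2 * (c + b) + e₂ * (b ^ 2 - c ^ 2)))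

/-- **SOUNDNESS of `faceLeverCheck`**: for all real `e₁ ≤ ε₁ < ε₂ ≤ e₂`, `dWeightFace(ε₂) < dWeightFace(ε₁)` at the σ point `(Δ, a, b, c)`. [folklore] -/
theorem dWeightFace_strictAnti_of_check {Δ a b c e₁ e₂ : ℚ} (h : faceLeverCheck Δ a b c e₁ e₂ = true) {ε₁ ε₂ : ℝ} (h1 : (e₁ : ℝ) ≤ ε₁) (h12 : ε₁ < ε₂)
    (h2 : ε₂ ≤ (e₂ : ℝ)) : dWeightFace (Δ : ℝ) a b c ε₂ < dWeightFace (Δ : ℝ) a b c ε₁ := by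
  simp only [faceLeverCheck, Bool.and_eq_true, decide_eq_true_eq] at h
  obtain ⟨⟨⟨⟨⟨⟨⟨hΔ, hc⟩, hcb⟩, ha⟩, he⟩, hm⟩, hlo⟩, hhi⟩ := h
  refine dWeightFace_strictAnti_of_edges (e₁ := (e₁ : ℝ)) (e₂ := (e₂ : ℝ)) (by exact_mod_cast hΔ) (by exact_mod_cast hc) (by exact_mod_cast hcb)
    (by exact_mod_cast ha) (by exact_mod_cast he) (by exact_mod_cast hm) ?_ ?_ h1 h12 h2
  · unfold faceG; exact_mod_cast hlo
  · unfold cA fsD fsN; exact_mod_cast hhi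

end Summit.Ventures.CertifiedManyBodySolver.Downfold.Emery
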